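import Summits.QuantumFields.YangMills.Theorems.UnitScaleTiltHalvingP1FlatCoreTopSizesOfTopRows
import Summits.QuantumFields.YangMills.Theorems.UnitScaleTiltHalvingP1FlatCoreSupplierRestr129
import Summits.QuantumFields.YangMills.Theorems.UnitScaleTiltHalvingP1FlatCoreSupplierLandau
import Summits.QuantumFields.YangMills.Theorems.UnitScaleTiltHalvingP1FlatCoreSupplierInduction
import Literature.MathematicalPhysics.QuantumFieldTheory.Balaban1983to89.B8SockHFPCubeMember
import Literature.MathematicalPhysics.QuantumFieldTheory.Balaban1983to89.B8Prop6OfThm4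
import HarnessLib

/-!
# `hP1room` PROGRAMME (LEAD-H «H = hSupUρ2», (K-site) «sizes»): ★★★ THE TWO (1.36) SIZE ROWS OF ONE SITE FROM THE TOP-STEP ROWS — ✓p647823 `hX_of_topRows` AT N05's CUBE
# MEMBER OF RECORD WITH ITS `h129` GUARD DISCHARGED (✓p650567) AND ITS LANDAU GUARD FROM THE TOP-STEP OUTPUT (✓p645467), THE TOP-KNIT CLAUSE DISPLAYED ABSTRACTLY

Route `UnitScaleTilt`, crux K1 child «MinimiserStabilityRegPr» (stmt-QuantumFields-19200), registered stub `stub_halvingStep` (`BirthV10`), display «H = hSupUρ2»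
(outer knit (K-0) over ✓p647313's 22 per-site rows; the «top half» rows by ✓`HalvingHSiteTopRowsOfSockets.siteTopRows_of_sockets`).  Cell `ym3-torus` (HUMAN RULING D-0037:
YM₃ on T³ is ladder rung R3 — NOT d = 4, NOT a mass gap, NOT the Clay problem), width seat `ym-ust-20520-w3` gen 6.  `--supports stmt-QuantumFields-19200 --as helper`;
THEOREMS ONLY (0 `def`, 0 `sorry`); count-neutral; nothing here claims `core′`, `hP1room(ρ2)`, `hSupU(ρ2)`, the stub, the crux or the gap.

WHAT.  ★★★ `siteSizeRows_of_topRows` — at N05's cube member OF RECORD (`Ω := cubeFam false L a M′ ρ′ (m+1)`, `Λs := cubeLamS …`, `Λb := cubeLamB …`, defining equations;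
level `k = m + 1`), from Theorem 4's datum `(u₁, W, A)` at level `m`, the top step's `λ′` with its OUTPUT rows (✓p646092∕✓p648920's conjuncts: `hsa hsupp h108 hmult (lo) hA0`),
J3's two rows for `U′` (`hInAk`, `hAxJ`), the JOIN windows (for the (1.29)-inversion) and Prop. 3's windows at `α₂ := 2(L·c⋆) + 8α₄`, the two Prop-3 sockets `H42`∕`H59` of
✓p644380 READ AT `Lan k V := IsLandau138W … V ∧ Q V` with an ABSTRACT top-knit clause `Q` (displayed row `hknit : Q (W^{λ′})`; at the torus member `Q V` := «`V` agrees with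
`(U♯)^{g′}` on the window bonds», ✓p645686 `gaugeActT_descent_eq_of_mgauge` at the gauge `u₁·e^{iλ′}` — the form ✓p645668 `H42_top_guarded` consumes) and the top family EMPTIED
in the (1.29) guard:  THE TWO (1.36) SIZE ROWS `hX1 hX2` of ✓p643656∕✓p647313 for `X₀ := logCfg η W^{λ′}`, `W^{λ′} := mgauge 1 (gaugeExp λ′)⁻¹ (cfgExp η A)`, at any constant
`Bε ≥ c⋆`.  MECHANISM (by name): member geometry (lit ✓`hΩ_cubeFam` ✓`htw_cubeLamS` ✓`h8lt_cubeLamS` ✓`h8top_cubeLamS` ✓`hbox_cubeLamB`), flat (1.33) ✓`one_inAk`, (1.34)∕(Ax)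
✓p647600 §1, the `h129` guard ✓p650567 `restr129_product_of_topRows`, the Landau guard ✓p645467 `landau_and_near_of_topStepOutput` transported from `e^{iηA}` to the datum field
`W` by lit ✓`isLandau138W_congr` (they agree on the bonds touching `□₀`), then ✓p647823 `hX_of_topRows`, then `c⋆ ≤ Bε`.
HONEST SCOPE: by-name composition; `H42`, `H59` (N05∕N06 sockets), `hknit` and the windows stay displayed; nothing of Prop. 3∕5, Theorem 4, [4], `core′` or the stub is proved.

References: T. Bałaban, CMP **99** (1985) 75–102 [Balaban1985RegularSpaces] (Prop. 3 (1.36)–(1.42) pp.82–83, (1.29) p.81, (1.68)–(1.69) p.88, (1.108) p.94, (1.131) p.99);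
CMP **99** (1985) 389–434 [Balaban1985BackgroundPropagators] (Thm 3.3 p.399); CMP **98** (1985) 17–51 [Balaban1985Averaging] (Prop. 10 (203)–(207) p.50).
-/

set_option autoImplicit false

noncomputable section

open scoped BigOperators
open NormedSpace
open Complex (I)

namespace Summit.QuantumFields.YangMills.Theorems.HalvingHSiteSizeRowsOfTopRows

open Literature.MathematicalPhysics.QuantumFieldTheory.Balaban1983to89
open MatrixLog (mlog)
open B7Prop1Explicit (e expUnit)
open B7Prop1Explicit renaming Site → LSite
open B7Prop2Explicit (unitaryUnits C0 c2' avgIter)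
open B7Prop3Flat (c3)
open B7Prop10General (C6 C4G)
open B7Prop9Flat (C5')
open B7Prop1Local (InBox loK bondHiK)
open B7Eq78Linearization (conjR)
open B7Eq92Concrete (mgauge mgauge_apply)
open B8Ineq130 (tlo thi)
open B8Ineq132 (covDerivFwd InAk BondTouches)
open B8Eq119TwistedAxial (Restr129 InAx)
open B8Eq131Cubes (cube)
open B8Eq131CubesAdmissible (cubeFam cubeFam_false_of_le)
open B8CubeMemberZd (cubeLamS cubeLamB hΩ_cubeFam hbox_cubeLamB)
open B8SockHFPCubeMember (htw_cubeLamS h8lt_cubeLamS h8top_cubeLamS)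
open B8Lemma1NonAbelian (mulCfg)
open B8Eq184Proof (gaugeExp cfgExp)
open B8Eq182Proof (gAd)
open B8Eq188Proof (frakF3)
open B8Eq140Level (SideTouches sideTouches_of_bondTouches)
open B8Eq146AExpansion (iEta)
open B8Eq138LandauZd (IsLandau138W covDivB covLap QT logCfg isLandau138W_congr)
open B7Prop4GeneralLevels (logCovIter linCovIter)
open B8Eq155JBound (Jcur wsup)
open B8ScaledSupNorm (bondNorm msup)
open B8LambdaSpaceKLevel (wt)
open B8Eq178Averages (Qnl)
open B8Prop6OfThm4 (one_inAk)
open HalvingP1FlatCoreTopSizes (hX_of_topRows)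
open HalvingP1FlatCoreSupplierRestr129 (restr129_product_of_topRows)
open HalvingP1FlatCoreSupplierLandau (landau_and_near_of_topStepOutput)
open HalvingP1FlatCoreSupplierInduction (h34_of_inAk_univ hAx_of_inAx_one)

variable {d : ℕ} {𝔸 : Type*} [CStarAlgebra 𝔸] [Nontrivial 𝔸]

/-- ★★★ **THE TWO (1.36) SIZE ROWS OF ONE SITE FROM THE TOP-STEP ROWS** — see the module docstring: ✓p647823 `hX_of_topRows` at N05's cube member of record with its
`h129` guard discharged (✓p650567), its Landau guard from the top-step output (✓p645467 + lit ✓`isLandau138W_congr`), the top-knit clause `Q` abstract (`hknit`), output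
weakened to any `Bε ≥ c⋆` — rows `hX1 hX2` of ✓p647313 `hSupBlock_of_topRows`. [cite: Balaban1985RegularSpaces, Prop. 3 (1.36)-(1.42) pp.82-83, (1.29) p.81, (1.68)-(1.69) p.88, (1.108) p.94, (1.131) p.99; Balaban1985BackgroundPropagators, Thm 3.3 p.399; Balaban1985Averaging, Prop. 10 (203)-(207) p.50] -/
theorem siteSizeRows_of_topRows (hd2 : 2 ≤ d) {η : ℝ} (hη : 0 < η) {L : ℕ} (hL : 2 ≤ L)
    -- N05's cube member OF RECORD (defining equations; callers write `rfl`), level `k = m + 1`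
    {a : LSite d} {M' ρ' : ℕ} (hρ' : L ≤ ρ') {m : ℕ}
    {Ω : ℕ → Set (LSite d)} (hΩdef : Ω = cubeFam false L a M' ρ' (m + 1))
    {Λs : ℕ → ℕ → Set (LSite d)} (hΛsdef : Λs = cubeLamS L a M' ρ' (m + 1))
    {Λb : ℕ → ℕ → Set (LSite d × Fin d)} (hΛbdef : Λb = cubeLamB L a M' ρ' (m + 1))
    -- the pre-gauged field: unitary, J3's (1.34)-𝔄 on `ℤᵈ` and axial rows (✓p647600 §1's currency)
    {U' : LSite d → Fin d → 𝔸ˣ} (hU' : ∀ x κ, U' x κ ∈ unitaryUnits 𝔸)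
    {α₀ α₁ α₄ B₀ cstar : ℝ} (hα₀ : 0 < α₀) (hα₁ : 0 < α₁) (hα₄ : 0 < α₄) (hB₀ : 0 < B₀)
    (hc : cstar = 5 * d * L * B₀ * (α₀ + α₁))
    (hInAk : InAk L (m + 1) η α₀ (fun _ => (Set.univ : Set (LSite d))) U')
    (hAxJ : ∀ m', m' ≤ m + 1 → ∀ Λ : ℕ → Set (LSite d), InAx L m' Λ (1 : LSite d → Fin d → 𝔸ˣ) U')
    -- Prop. 3's windows at `(α₀, α₂ := 2(L·c⋆) + 8α₄)` (✓p647823's, VERBATIM)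
    (hα3 : C0 d * α₀ ≤ 1 / 3) (hα4 : 4 * α₀ ≤ c2' d L)
    (h16 : 16 * (2 * (L * cstar) + 8 * α₄) ≤ 1) (hd5 : 5 * (2 * (L * cstar) + 8 * α₄) * ((d : ℝ) - 1) ≤ 4)
    (hsmallP : Real.exp (4 * (800 * ((d : ℝ) + 1) ^ 2 * ((d : ℝ) + 4)) * α₀)
      * (1 + 8 * (131072 * ((d : ℝ) + 1) ^ 2) * (2 * (L * cstar) + 8 * α₄)) ≤ 2)
    (hc₃P : 2 * (2 * (L * cstar) + 8 * α₄) ≤ c3 d L) (hside : 36 * d * B₀ * (2 * (L * cstar) + 8 * α₄) ≤ 1 / 2)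
    (h50 : 50 * d * (2 * (L * cstar) + 8 * α₄) ≤ 1)
    {C₂ : ℝ} (hC₂ : 8 * (131072 * ((d : ℝ) + 1) ^ 2) * Real.exp (4 * (800 * ((d : ℝ) + 1) ^ 2 * ((d : ℝ) + 4)) * α₀) ≤ C₂)
    (h61 : 2 * (2 * (L * cstar) + 8 * α₄) ^ 2 + 20 * d * α₀ * (2 * (L * cstar) + 8 * α₄)
      + 2 * C₂ * (2 * (L * cstar) + 8 * α₄) ^ 2 ≤ α₀ + α₁)
    -- the JOIN's windows (✓p646092's, the subset the (1.29)-inversion ✓p650567 reads)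
    {cB : ℝ} (hcBlo : L * cstar ≤ cB)
    (hsmall : Real.exp (4 * (800 * ((d : ℝ) + 1) ^ 2 * ((d : ℝ) + 4)) * α₀) * (1 + 8 * (131072 * ((d : ℝ) + 1) ^ 2) * cB) ≤ 2)
    (hc₃ : 2 * cB ≤ c3 d L) (hsc : 2048 * (d : ℝ) * cB ≤ 1) (hα₃' : 40 * d * cB ≤ 1 / 200)
    (hs₁ : 200 * C6 d * (2 * α₄) ≤ 1) (hs₂ : 12000 * ((d : ℝ) + 1) * L * (2 * α₄) ≤ 1)
    (hs₃ : C4G d L * (α₀ + 40 * d * cB + 4 * (2 * α₄)) ≤ 1)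
    (hs₄ : 1024 * ((d : ℝ) + 1) * ((d : ℝ) + 4) * L ^ 2 * α₀ ≤ 1) (hs₅ : 32 * ((d : ℝ) + 1) ^ 2 * C6 d * L ^ 2 * α₀ ≤ 1)
    (hs₆ : 16 * d * C5' d * C6 d * (L : ℝ) ^ 2 * α₀ ≤ 1)
    (hprod8 : 2 * C6 d * (40 * d * cB + 4 * α₄) ≤ 1 / 8)
    -- the two Prop-3 sockets of ✓p644380 READ AT `Lan k V := IsLandau138W … V ∧ Q V`, top family emptied in the (1.29) guard (N05∕N06; `H42` ⟸ ✓p645668 at the torus knit `Q`)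
    (Q : (LSite d → Fin d → 𝔸ˣ) → Prop)
    (H42 : ∀ (u : LSite d → 𝔸ˣ) (V : LSite d → Fin d → 𝔸ˣ) (A' : LSite d → Fin d → 𝔸),
      (∀ x, u x ∈ unitaryUnits 𝔸) → mgauge (1 : LSite d → Fin d → 𝔸ˣ) u V = U' →
      Restr129 L (m + 1) (Function.update (Λs (m + 1)) (m + 1) ∅) (1 : LSite d → Fin d → 𝔸ˣ) u →
      (IsLandau138W L (m + 1) η (Ω 0) (Λs (m + 1)) (1 : LSite d → Fin d → 𝔸ˣ) V ∧ Q V) →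
      (∀ y τ, IsSelfAdjoint (A' y τ)) →
      (∀ j, j ≤ m + 1 → ∀ y τ, SideTouches (Ω j) y τ →
        V y τ = cfgExp η A' y τ ∧ ‖A' y τ‖ ≤ (2 * (L * cstar) + 8 * α₄) * ((L : ℝ) ^ j * η)⁻¹) →
      (∀ y τ, (∀ j, j ≤ m + 1 → ¬ SideTouches (Ω j) y τ) → A' y τ = 0) →
      ∀ j, j ≤ m + 1 → ∀ c ∈ Λb (m + 1) j, ‖logCovIter L (1 : LSite d → Fin d → 𝔸ˣ) (iEta η A') j c.1 c.2‖ < 2 * d * L * α₁)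
    (H59 : ∀ (u : LSite d → 𝔸ˣ) (V : LSite d → Fin d → 𝔸ˣ) (A' : LSite d → Fin d → 𝔸),
      (∀ x, u x ∈ unitaryUnits 𝔸) → mgauge (1 : LSite d → Fin d → 𝔸ˣ) u V = U' →
      Restr129 L (m + 1) (Function.update (Λs (m + 1)) (m + 1) ∅) (1 : LSite d → Fin d → 𝔸ˣ) u →
      (IsLandau138W L (m + 1) η (Ω 0) (Λs (m + 1)) (1 : LSite d → Fin d → 𝔸ˣ) V ∧ Q V) →
      (∀ y τ, IsSelfAdjoint (A' y τ)) →
      (∀ j, j ≤ m + 1 → ∀ y τ, SideTouches (Ω j) y τ →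
        V y τ = cfgExp η A' y τ ∧ ‖A' y τ‖ ≤ (2 * (L * cstar) + 8 * α₄) * ((L : ℝ) ^ j * η)⁻¹) →
      (∀ y τ, (∀ j, j ≤ m + 1 → ¬ SideTouches (Ω j) y τ) → A' y τ = 0) →
      msup L (m + 1) η (-(1 : ℝ)) (fun j (b : LSite d × Fin d) => SideTouches (Ω j) b.1 b.2) (fun b => A' b.1 b.2)
          ≤ B₀ * (bondNorm L (m + 1) η (-(3 : ℝ)) Ω (fun x μ => Jcur η (1 : LSite d → Fin d → 𝔸ˣ) A' μ x)
            + wsup 1 (fun p : {p : ℕ × (LSite d × Fin d) // p.1 ≤ m + 1 ∧ p.2 ∈ Λb (m + 1) p.1} =>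
                linCovIter L (1 : LSite d → Fin d → 𝔸ˣ) (iEta η A') p.1.1 p.1.2.1 p.1.2.2)) ∧
        msup L (m + 1) η (-(2 : ℝ)) (fun j (t : Fin d × Fin d × LSite d) => SideTouches (Ω j) t.2.2 t.2.1)
            (fun t => covDerivFwd η (1 : LSite d → Fin d → 𝔸ˣ) t.1 (fun z => A' z t.2.1) t.2.2)
          ≤ B₀ * (bondNorm L (m + 1) η (-(3 : ℝ)) Ω (fun x μ => Jcur η (1 : LSite d → Fin d → 𝔸ˣ) A' μ x)
            + wsup 1 (fun p : {p : ℕ × (LSite d × Fin d) // p.1 ≤ m + 1 ∧ p.2 ∈ Λb (m + 1) p.1} =>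
                linCovIter L (1 : LSite d → Fin d → 𝔸ˣ) (iEta η A') p.1.1 p.1.2.1 p.1.2.2)))
    -- Theorem 4's datum at level `m` (N05's letters, as ✓p647600 emits them)
    {u₁ : LSite d → 𝔸ˣ} {W : LSite d → Fin d → 𝔸ˣ} {A : LSite d → Fin d → 𝔸}
    (hu₁ : ∀ x, u₁ x ∈ unitaryUnits 𝔸) (hWd : mgauge (1 : LSite d → Fin d → 𝔸ˣ) u₁ W = U')
    (h129 : Restr129 L m (Λs m) (1 : LSite d → Fin d → 𝔸ˣ) u₁)
    (hdat : ∀ j, j ≤ m → ∀ b ∈ {b : LSite d × Fin d | SideTouches (Ω j) b.1 b.2},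
      W b.1 b.2 = cfgExp η A b.1 b.2 ∧ IsSelfAdjoint (A b.1 b.2) ∧ ‖A b.1 b.2‖ ≤ cstar * ((L : ℝ) ^ j * η)⁻¹)
    -- the top step's `λ′` with its OUTPUT rows (✓p646092∕✓p648920's conjuncts `hsa hsupp h108 hmult (lo) hA0`) and their two windows
    {lam : LSite d → 𝔸} {cA : ℝ} (hα70 : α₄ ≤ 1 / 70) (hcA0 : 0 ≤ cA) (hcA : cA ≤ 1 / 12)
    (hsa : ∀ x, IsSelfAdjoint (lam x)) (hsupp : ∀ x, x ∉ Ω 0 → lam x = 0)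
    (h108 : ∀ j, j ≤ m + 1 → ∀ b ∈ {b : LSite d × Fin d | SideTouches (Ω j) b.1 b.2},
      ‖lam b.1‖ ≤ α₄ ∧ wt L η j * ‖covDerivFwd η (1 : LSite d → Fin d → 𝔸ˣ) b.2 lam b.1‖ ≤ α₄)
    (hmult : ∃ μ : ℕ → LSite d → 𝔸, ∀ x ∈ Ω 0,
      covLap η (1 : LSite d → Fin d → 𝔸ˣ) ((Ω 0).indicator fun y =>
        covDivB η (1 : LSite d → Fin d → 𝔸ˣ) A y + covLap η (1 : LSite d → Fin d → 𝔸ˣ) lam y +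
        ((conjR (gaugeExp lam y)⁻¹ (covDivB η (1 : LSite d → Fin d → 𝔸ˣ) A y) - covDivB η (1 : LSite d → Fin d → 𝔸ˣ) A y) +
          (gAd (covLap η (1 : LSite d → Fin d → 𝔸ˣ) lam y) (lam y) - covLap η (1 : LSite d → Fin d → 𝔸ˣ) lam y) +
          ∑ μ, frakF3 η (1 : LSite d → Fin d → 𝔸ˣ) lam A y μ)) x = QT L (m + 1) (Λs (m + 1)) (1 : LSite d → Fin d → 𝔸ˣ) μ x)
    (hlo : ∀ j, j < m + 1 → ∀ y ∈ Λs (m + 1) j, Qnl L (1 : LSite d → Fin d → 𝔸ˣ) (expUnit ∘ ((-I) • lam)) u₁⁻¹ j y = 0)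
    (hA0 : ∀ x ∈ Ω 0, ∀ μ : Fin d,
      wt L η 0 * ‖A x μ‖ ≤ cA ∧ wt L η 0 * ‖conjR ((1 : LSite d → Fin d → 𝔸ˣ) (x - e μ) μ)⁻¹ (A (x - e μ) μ)‖ ≤ cA)
    -- the top-knit clause for the gauge-fixed datum field (displayed; torus: ✓p645686 at the gauge `u₁·e^{iλ′}`)
    (hknit : Q (mgauge (1 : LSite d → Fin d → 𝔸ˣ) (gaugeExp lam)⁻¹ W))
    -- the output constant, and `η⁻¹ = L^{m+1}` (the composer's `η := L^{−(m+1)}`)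
    {Bε : ℝ} (hcsB : cstar ≤ Bε) (hηL : η⁻¹ = (L : ℝ) ^ (m + 1)) :
    (∀ j, j ≤ m + 1 → ∀ z ∈ cube L a M' ρ' (m + 1) j, ∀ ν' : Fin d,
      (L : ℝ) ^ j * η * ‖logCfg η (mgauge (1 : LSite d → Fin d → 𝔸ˣ) (gaugeExp lam)⁻¹ (cfgExp η A)) z ν'‖ ≤ Bε) ∧
    (∀ j, j ≤ m + 1 → ∀ z ∈ cube L a M' ρ' (m + 1) j, ∀ ν' μ' : Fin d, z + e μ' ∈ cube L a M' ρ' (m + 1) 0 →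
      ((L : ℝ) ^ j * η) ^ 2 * (L : ℝ) ^ (m + 1) *
        ‖logCfg η (mgauge (1 : LSite d → Fin d → 𝔸ˣ) (gaugeExp lam)⁻¹ (cfgExp η A)) (z + e μ') ν' -
          logCfg η (mgauge (1 : LSite d → Fin d → 𝔸ˣ) (gaugeExp lam)⁻¹ (cfgExp η A)) z ν'‖ ≤ Bε) := by
  subst hΩdef hΛsdef hΛbdef hc
  have hL1 : 1 ≤ L := le_trans (by norm_num) hL
  have hLr : (1 : ℝ) ≤ L := by exact_mod_cast hL1
  have hcs0 : 0 ≤ 5 * (d : ℝ) * L * B₀ * (α₀ + α₁) := by positivity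
  -- the member geometry BY NAME
  have hΩ := hΩ_cubeFam (d := d) hL1 a M' hρ' (m + 1)
  have hbox := hbox_cubeLamB (d := d) L a M' ρ' (m + 1)
  have htower := htw_cubeLamS (d := d) hL1 a M' ρ' (m + 1) (m + 1) le_rfl
  have hlt := h8lt_cubeLamS (d := d) L a M' ρ' (m + 1) m (lt_add_one m)
  have htop := h8top_cubeLamS (d := d) hL1 a M' ρ' (m + 1) m (lt_add_one m)
  -- the pre-gauged field's rows at the flat background
  have h33 : InAk L (m + 1) η α₀ (cubeFam false L a M' ρ' (m + 1)) (1 : LSite d → Fin d → 𝔸ˣ) := one_inAk hL1 (m + 1) hη hα₀ _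
  have h34 := h34_of_inAk_univ hInAk (cubeFam false L a M' ρ' (m + 1))
  have hAx := hAx_of_inAx_one hAxJ (cubeLamS L a M' ρ' (m + 1))
  -- the (1.29) guard of the composite gauge below the top (✓p650567)
  have h129c := restr129_product_of_topRows hd2 hL hη hΩ (lt_add_one m) htower hlt htop hα₀ hα₁ hB₀ hα₄ rfl h33 h34 hAx hu₁ hWd h129 hdat
    hcBlo hα3 hα4 hsmall hc₃ hsc hα₃' hs₁ hs₂ hs₃ hs₄ hs₅ hs₆ hprod8 h108 hlo
  -- the Landau guard: (1.38) of `e^{iηA}` gauge-fixed (✓p645467), transported to the datum field (they agree on the bonds touching `□₀`)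
  have hLanE := (landau_and_near_of_topStepOutput hd2 hη L (m + 1) (cubeFam false L a M' ρ' (m + 1) 0) (cubeLamS L a M' ρ' (m + 1) (m + 1))
    hα₄.le hα70 hcA0 hcA hsupp (h108 0 (Nat.zero_le _)) hA0 hmult).1
  haveI : Nontrivial (Fin d) := Fin.nontrivial_iff_two_le.mpr hd2
  have hagree : ∀ (x : LSite d) (μ : Fin d), BondTouches (cubeFam false L a M' ρ' (m + 1) 0) x μ →
      mgauge (1 : LSite d → Fin d → 𝔸ˣ) (gaugeExp lam)⁻¹ W x μ = mgauge (1 : LSite d → Fin d → 𝔸ˣ) (gaugeExp lam)⁻¹ (cfgExp η A) x μ := by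
    intro x μ hb
    obtain ⟨κ, hκ⟩ := exists_ne μ
    have hs : SideTouches (cubeFam false L a M' ρ' (m + 1) 0) x μ := sideTouches_of_bondTouches hκ hb
    rw [mgauge_apply, mgauge_apply, (hdat 0 (Nat.zero_le _) (x, μ) hs).1]
  have hLanW : IsLandau138W L (m + 1) η (cubeFam false L a M' ρ' (m + 1) 0) (cubeLamS L a M' ρ' (m + 1) (m + 1)) (1 : LSite d → Fin d → 𝔸ˣ)
      (mgauge (1 : LSite d → Fin d → 𝔸ˣ) (gaugeExp lam)⁻¹ W) := (isLandau138W_congr η L _ hagree).2 hLanE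
  -- the level cubes inside the member's domains (by definition)
  have hΩcube : ∀ j, j ≤ m + 1 → cube L a M' ρ' (m + 1) j ⊆ cubeFam false L a M' ρ' (m + 1) j := fun j hj => by
    rw [cubeFam_false_of_le L a M' ρ' hj]
  -- ✓p647823 BY NAME at `Lan k V := IsLandau138W … V ∧ Q V`, `Λs′ k := Function.update (Λs k) k ∅`
  obtain ⟨hX1, hX2⟩ := hX_of_topRows hd2 hη hL (Nat.succ_le_succ (Nat.zero_le m)) hU' hα₀ hα₁.le hα₄.le hB₀.le rfl hα3 hα4 h16 hd5 hsmallP hc₃P hside h50 hC₂ h61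
    (cubeFam false L a M' ρ' (m + 1)) hΩ (fun _ => Function.update (cubeLamS L a M' ρ' (m + 1) (m + 1)) (m + 1) ∅) (cubeLamB L a M' ρ' (m + 1))
    (hbox (m + 1) le_rfl) h33 h34
    (fun k V => IsLandau138W L k η (cubeFam false L a M' ρ' (m + 1) 0) (cubeLamS L a M' ρ' (m + 1) k) (1 : LSite d → Fin d → 𝔸ˣ) V ∧ Q V)
    H42 H59 u₁ W A hu₁ hWd (fun j hj y τ hs => hdat j (by omega) (y, τ) hs) lam hsa (fun j hj y τ hs => h108 j hj (y, τ) hs) h129c ⟨hLanW, hknit⟩ hΩcube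
  refine ⟨fun j hj z hz ν' => (hX1 j hj z hz ν').trans hcsB, fun j hj z hz ν' μ' hz' => ?_⟩
  rw [← hηL]
  exact (hX2 j hj z hz ν' μ' hz').trans hcsB

end Summit.QuantumFields.YangMills.Theorems.HalvingHSiteSizeRowsOfTopRows

end
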